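import Summits.BirchSwinnertonDyer.BirchSwinnertonDyer.Theorems.Rank2ObservatoryRank3WitnessT
import HarnessLib

/-!
# BirchSwinnertonDyer — rank ≥ 2 observatory: rank-3 kernel certificate, torsion exponent from a rational 2-torsion point

HONEST FRAMING: per-curve certified theorems and census instruments; no claim on BSD in rank ≥ 2.

Second sharpening of the torsion `2`-exponent for the rank-3 kernel certificates. Cert-1's `noOrder4`
(`Rank2ObservatoryKernelAnnihilator2`) needs a good odd prime at which `Ẽ(𝔽_ℓ)` has NO element of
order `4`; the two-isogenous partner `E` of a curve with a rational `4`-torsion point has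
`E(ℚ)_tors ≅ ℤ/2` but an element of order `4` in `Ẽ(𝔽_ℓ)` at every good odd `ℓ` (7 rank-3 census
rows). For such curves two cheaper kernel inputs suffice: the rational `2`-torsion point
`T = (x_T, y_T)` (integral, `2y_T + a₁x_T + a₃ = 0`), a good odd prime `q₁` at which `T̃` is the ONLY
affine `2`-torsion point of `Ẽ(𝔽_{q₁})` (`twoTorsionOnlyB`; then `E(ℚ)[2] = {O, T}` by injectivity of
reduction on `2`-power torsion), and a good prime `q₂` with `T̃ ∉ 2Ẽ(𝔽_{q₂})` (`xDoubleFree`; then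
`T ∉ 2E(ℚ)`). Hence `4 • w = 0 → 2 • w = 0` in `E(ℚ)` (`2w ∈ {O, T}` and `2w = T` is impossible), the
annihilator `t = 2^e·m` from the kernel point counts improves to `2m`, and the certificate
`three_le_mordellWeilRank_of_kernelCertT2` runs the seven coset tests at `u = 1`.
Sorry-free. References: Silverman AEC (2009) III.2.3, VII.3.1(b), VIII.6.7; Cremona (1997) §3.5.
-/

-- single-conjunct summit: `Summit.BirchSwinnertonDyer.BirchSwinnertonDyer.…` repeats the name by design
set_option linter.dupNamespace false

namespace Summit.BirchSwinnertonDyer.BirchSwinnertonDyer.Rank2Observatory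

open WeierstrassCurve Literature.NumberTheory.EllipticCurves

section TwoTorsionWitness

variable (V : WeierstrassCurve ℤ)

/-- Boolean: every affine point `(β, γ)` of `Ẽ(𝔽_q)` with `2γ + a₁β + a₃ = 0` (a non-zero `2`-torsion
point) is the reduction of the given integral point `(x_T, y_T)`. [cite: SilvermanAEC2009, III.2.3] -/
def twoTorsionOnlyB (V : WeierstrassCurve ℤ) (q : ℕ) [NeZero q] (xT yT : ℤ) : Bool :=
  decide (∀ β γ : ZMod q,
    γ ^ 2 + (V.a₁ : ZMod q) * β * γ + (V.a₃ : ZMod q) * γ =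
      β ^ 3 + (V.a₂ : ZMod q) * β ^ 2 + (V.a₄ : ZMod q) * β + (V.a₆ : ZMod q) →
    2 * γ + (V.a₁ : ZMod q) * β + (V.a₃ : ZMod q) = 0 → β = (xT : ZMod q) ∧ γ = (yT : ZMod q))

/-- Soundness of `twoTorsionOnlyB` in `Ẽ(𝔽_q)`: a point `z` with `2 • z = 0` is `O` or the reduction
`(x_T, y_T)` of the given point. [cite: SilvermanAEC2009, III.2.3] -/
theorem eq_zero_or_eq_of_twoTorsionOnlyB (q : ℕ) [Fact q.Prime] {xT yT : ℤ}
    (h1 : twoTorsionOnlyB V q xT yT = true)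
    (z : (V.map (Int.castRingHom (ZMod q))).toAffine.Point) (hz : 2 • z = 0) :
    z = 0 ∨ ∃ hns, z = Affine.Point.some (xT : ZMod q) (yT : ZMod q) hns := by
  classical
  simp only [twoTorsionOnlyB, decide_eq_true_eq] at h1
  rcases z with _ | ⟨β, γ, hns⟩
  · exact Or.inl rfl
  · right
    have ha₁ : (V.map (Int.castRingHom (ZMod q))).a₁ = (V.a₁ : ZMod q) := by
      simp [WeierstrassCurve.map]
    have ha₂ : (V.map (Int.castRingHom (ZMod q))).a₂ = (V.a₂ : ZMod q) := by
      simp [WeierstrassCurve.map]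
    have ha₃ : (V.map (Int.castRingHom (ZMod q))).a₃ = (V.a₃ : ZMod q) := by
      simp [WeierstrassCurve.map]
    have ha₄ : (V.map (Int.castRingHom (ZMod q))).a₄ = (V.a₄ : ZMod q) := by
      simp [WeierstrassCurve.map]
    have ha₆ : (V.map (Int.castRingHom (ZMod q))).a₆ = (V.a₆ : ZMod q) := by
      simp [WeierstrassCurve.map]
    have heq : γ ^ 2 + (V.a₁ : ZMod q) * β * γ + (V.a₃ : ZMod q) * γ =
        β ^ 3 + (V.a₂ : ZMod q) * β ^ 2 + (V.a₄ : ZMod q) * β + (V.a₆ : ZMod q) := by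
      have e := (Affine.equation_iff β γ).mp hns.left
      rwa [ha₁, ha₂, ha₃, ha₄, ha₆] at e
    rw [two_nsmul] at hz
    have hneg : Affine.Point.some β γ hns = -Affine.Point.some β γ hns := eq_neg_of_add_eq_zero_left hz
    rw [Affine.Point.neg_some, Affine.Point.some.injEq] at hneg
    have h2t : 2 * γ + (V.a₁ : ZMod q) * β + (V.a₃ : ZMod q) = 0 := by
      have hγ := hneg.2
      rw [Affine.negY, ha₁, ha₃] at hγ
      linear_combination hγ
    obtain ⟨hβ, hγ⟩ := h1 β γ heq h2t
    subst hβ; subst hγ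
    exact ⟨hns, rfl⟩

open scoped Classical in
/-- **No point of order 4 in `E(ℚ)`** from a rational `2`-torsion point `T = (x_T, y_T)`, a good odd
prime `q₁` with `twoTorsionOnlyB V q₁ x_T y_T` and a good prime `q₂` with `xDoubleFree V q₂ x_T`:
`4 • w = 0 → 2 • w = 0`. (`2w` is `2`-torsion; mod `q₁` it is `O` or `T̃`, so `2w ∈ {O, T}` by
injectivity on prime-to-`q₁` torsion; `2w = T` would make `T̃` a double mod `q₂`.)
[cite: SilvermanAEC2009, Prop. VII.3.1(b)] -/
theorem two_nsmul_eq_zero_of_twoTorsionWitness {xT yT : ℤ}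
    (hT : yT ^ 2 + V.a₁ * xT * yT + V.a₃ * yT = xT ^ 3 + V.a₂ * xT ^ 2 + V.a₄ * xT + V.a₆)
    (hT2 : 2 * yT + V.a₁ * xT + V.a₃ = 0)
    (q₁ : ℕ) [Fact q₁.Prime] (hq₁ : ¬ (q₁ : ℤ) ∣ V.Δ) (hodd : q₁ ≠ 2)
    (h1 : twoTorsionOnlyB V q₁ xT yT = true)
    (q₂ : ℕ) [Fact q₂.Prime] (hq₂ : ¬ (q₂ : ℤ) ∣ V.Δ) (h2 : xDoubleFree V q₂ (xT : ZMod q₂) = true)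
    (w : (V.map (Int.castRingHom ℚ)).toAffine.Point) (h : 4 • w = 0) : 2 • w = 0 := by
  have hΔ : V.Δ ≠ 0 := Δ_ne_zero_of_not_dvd V hq₁
  haveI := isElliptic_rat V hΔ
  have hn : ¬ q₁ ∣ 2 := fun hd =>
    hodd ((Nat.prime_dvd_prime_iff_eq (Fact.out : q₁.Prime) Nat.prime_two).mp hd)
  have eT : V.toAffine.Equation xT yT := (Affine.equation_iff xT yT).mpr hT
  set T : (V.map (Int.castRingHom ℚ)).toAffine.Point :=
    .some (xT : ℚ) (yT : ℚ) (nonsingular_rat_of_eq V hΔ hT) with hTdef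
  have h4w : 2 • (2 • w) = 0 := by rw [← mul_nsmul]; exact h
  -- mod q₁: `2w` reduces to `O` or `T̃`
  have hred2 : 2 • reduceMod V q₁ hq₁ (2 • w) = 0 := by rw [← map_nsmul, h4w, map_zero]
  rcases eq_zero_or_eq_of_twoTorsionOnlyB V q₁ h1 _ hred2 with h0 | ⟨hns, hsome⟩
  · exact eq_zero_of_reduceMod_eq_zero V q₁ hq₁ (2 • w) hn h4w h0
  · exfalso
    -- `2w - T` is `2`-torsion and reduces to `O` mod `q₁`, hence `2w = T`
    have hTred : reduceMod V q₁ hq₁ T = Affine.Point.some (xT : ZMod q₁) (yT : ZMod q₁) hns := by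
      rw [hTdef, reduceMod_some V q₁ hq₁ eT]
    have h2T : 2 • T = 0 := by
      rw [hTdef, two_nsmul, ← sub_neg_eq_add, sub_eq_zero, Affine.Point.neg_some]
      congr 1
      simp only [Affine.negY, WeierstrassCurve.map, eq_intCast]
      have : (2 : ℚ) * yT + V.a₁ * xT + V.a₃ = 0 := by exact_mod_cast hT2
      linarith
    have hdiff0 : reduceMod V q₁ hq₁ (2 • w - T) = 0 := by
      rw [map_sub, hsome, hTred, sub_self]
    have hdiff2 : 2 • (2 • w - T) = 0 := by rw [nsmul_sub, h4w, h2T, sub_zero]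
    have hwT : 2 • w = T :=
      sub_eq_zero.mp (eq_zero_of_reduceMod_eq_zero V q₁ hq₁ (2 • w - T) hn hdiff2 hdiff0)
    -- mod q₂: `T̃ = 2 w̃` contradicts `xDoubleFree`
    have hmem : (Affine.Point.some (xT : ZMod q₂) (yT : ZMod q₂)
        (nonsingular_zmod_of_equation V q₂ hq₂ eT) : (V.map (Int.castRingHom (ZMod q₂))).toAffine.Point)
          ∈ twoCoset (V.map (Int.castRingHom (ZMod q₂))).toAffine.Point 0 := by
      refine ⟨reduceMod V q₂ hq₂ w, 0, by simp, ?_⟩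
      rw [two_zsmul, add_zero, ← two_nsmul, ← map_nsmul, hwT, hTdef, reduceMod_some V q₂ hq₂ eT]
    exact not_mem_twoCoset_of_xDoubleFree V q₂ h2 _ hmem

end TwoTorsionWitness

/-! ### The sharpened annihilator and the certificate variant -/

section Assembly

variable (V : WeierstrassCurve ℤ)

open scoped Classical in
/-- **`2m` kills `E(ℚ)_tors`** when `t = 2^e·m` does (`annihilatorCheck`) and `E(ℚ)` has no point of
order `4` by `two_nsmul_eq_zero_of_twoTorsionWitness`. [cite: SilvermanAEC2009, Prop. VII.3.1(b)] -/
theorem torsion_zsmul_eq_zero_of_twoTorsionWitness {S : List (ℕ × ℕ)} {t e m : ℕ} (hte : t = 2 ^ e * m)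
    (hS : ∀ ℓN ∈ S, ℓN.1.Prime ∧
      ∀ (x : (V.map (Int.castRingHom ℚ)).toAffine.Point) (n : ℕ), ¬ ℓN.1 ∣ n → n • x = 0 →
        ℓN.2 • x = 0)
    (ht : annihilatorCheck S t = true) {xT yT : ℤ}
    (hT : yT ^ 2 + V.a₁ * xT * yT + V.a₃ * yT = xT ^ 3 + V.a₂ * xT ^ 2 + V.a₄ * xT + V.a₆)
    (hT2 : 2 * yT + V.a₁ * xT + V.a₃ = 0)
    (ℓ₁ : ℕ) [Fact ℓ₁.Prime] (hℓ₁ : ¬ (ℓ₁ : ℤ) ∣ V.Δ) (hodd : ℓ₁ ≠ 2)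
    (hB₁ : twoTorsionOnlyB V ℓ₁ xT yT = true)
    (ℓ₂ : ℕ) [Fact ℓ₂.Prime] (hℓ₂ : ¬ (ℓ₂ : ℤ) ∣ V.Δ) (hB₂ : xDoubleFree V ℓ₂ (xT : ZMod ℓ₂) = true)
    (x : (V.map (Int.castRingHom ℚ)).toAffine.Point) (hx : IsOfFinAddOrder x) :
    ((2 : ℤ) ^ 1 * (m : ℤ)) • x = 0 := by
  have htx : t • x = 0 := nsmul_eq_zero_of_annihilatorCheck hS ht hx
  rw [hte, mul_nsmul'] at htx
  rw [pow_one, ← Nat.cast_ofNat, ← Nat.cast_mul, natCast_zsmul, mul_nsmul']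
  -- descend: `2^(k+1) • z = 0 → 2 • z = 0`
  have key : ∀ k : ℕ, ∀ z : (V.map (Int.castRingHom ℚ)).toAffine.Point,
      2 ^ (k + 1) • z = 0 → 2 • z = 0 := by
    intro k
    induction k with
    | zero => intro z hz; simpa using hz
    | succ k ih =>
      intro z hz
      apply ih
      have hz4 : 4 • (2 ^ k • z) = 0 := by
        rw [← mul_nsmul', show 4 * 2 ^ k = 2 ^ (k + 1 + 1) by ring]; exact hz
      have h2 := two_nsmul_eq_zero_of_twoTorsionWitness V hT hT2 ℓ₁ hℓ₁ hodd hB₁ ℓ₂ hℓ₂ hB₂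
        (2 ^ k • z) hz4
      rwa [← mul_nsmul', show 2 * 2 ^ k = 2 ^ (k + 1) by ring] at h2
  cases e with
  | zero => rw [pow_zero, one_nsmul] at htx; rw [htx, nsmul_zero]
  | succ k => exact key k _ htx

/-- **Rank-3 kernel certificate, torsion exponent from a rational `2`-torsion point**: as
`three_le_mordellWeilRank_of_kernelCertT` but the `2`-exponent of the annihilator `t = 2^e·m` is
lowered to `u = 1` by the rational `2`-torsion point `(x_T, y_T)`, a good odd prime `ℓ₁` with
`twoTorsionOnlyB V ℓ₁ x_T y_T` and a good prime `ℓ₂` with `xDoubleFree V ℓ₂ x_T`; the seven coset tests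
are `cosetFreeB V q 1`. [cite: CremonaAlgorithms1997, §3.5]
[cite: SilvermanAEC2009, Thm. VIII.6.7] -/
theorem three_le_mordellWeilRank_of_kernelCertT2 {X₁ Y₁ X₂ Y₂ X₃ Y₃ : ℤ}
    (h₁ : Y₁ ^ 2 + V.a₁ * X₁ * Y₁ + V.a₃ * Y₁ = X₁ ^ 3 + V.a₂ * X₁ ^ 2 + V.a₄ * X₁ + V.a₆)
    (h₂ : Y₂ ^ 2 + V.a₁ * X₂ * Y₂ + V.a₃ * Y₂ = X₂ ^ 3 + V.a₂ * X₂ ^ 2 + V.a₄ * X₂ + V.a₆)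
    (h₃ : Y₃ ^ 2 + V.a₁ * X₃ * Y₃ + V.a₃ * Y₃ = X₃ ^ 3 + V.a₂ * X₃ ^ 2 + V.a₄ * X₃ + V.a₆)
    {S : List (ℕ × ℕ)} {t e m : ℕ} (hm : m % 2 = 1) (hte : t = 2 ^ e * m)
    (hS : ∀ ℓN ∈ S, ℓN.1.Prime ∧
      ∀ (x : (V.map (Int.castRingHom ℚ)).toAffine.Point) (n : ℕ), ¬ ℓN.1 ∣ n → n • x = 0 →
        ℓN.2 • x = 0)
    (ht : annihilatorCheck S t = true)
    {xT yT : ℤ}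
    (hT : yT ^ 2 + V.a₁ * xT * yT + V.a₃ * yT = xT ^ 3 + V.a₂ * xT ^ 2 + V.a₄ * xT + V.a₆)
    (hT2 : 2 * yT + V.a₁ * xT + V.a₃ = 0)
    (ℓ₁ : ℕ) [Fact ℓ₁.Prime] (hℓ₁ : ¬ (ℓ₁ : ℤ) ∣ V.Δ) (hodd : ℓ₁ ≠ 2)
    (hB₁ : twoTorsionOnlyB V ℓ₁ xT yT = true)
    (ℓ₂ : ℕ) [Fact ℓ₂.Prime] (hℓ₂ : ¬ (ℓ₂ : ℤ) ∣ V.Δ) (hB₂ : xDoubleFree V ℓ₂ (xT : ZMod ℓ₂) = true)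
    (q₁ q₂ q₃ q₁₂ q₁₃ q₂₃ q₁₂₃ : ℕ) [Fact q₁.Prime] [Fact q₂.Prime] [Fact q₃.Prime]
    [Fact q₁₂.Prime] [Fact q₁₃.Prime] [Fact q₂₃.Prime] [Fact q₁₂₃.Prime]
    (hq₁ : ¬ (q₁ : ℤ) ∣ V.Δ) (hq₂ : ¬ (q₂ : ℤ) ∣ V.Δ) (hq₃ : ¬ (q₃ : ℤ) ∣ V.Δ)
    (hq₁₂ : ¬ (q₁₂ : ℤ) ∣ V.Δ) (hq₁₃ : ¬ (q₁₃ : ℤ) ∣ V.Δ) (hq₂₃ : ¬ (q₂₃ : ℤ) ∣ V.Δ)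
    (hq₁₂₃ : ¬ (q₁₂₃ : ℤ) ∣ V.Δ)
    (hw₁ : cosetFreeB V q₁ 1 (X₁ : ZMod q₁) (Y₁ : ZMod q₁) = true)
    (hw₂ : cosetFreeB V q₂ 1 (X₂ : ZMod q₂) (Y₂ : ZMod q₂) = true)
    (hw₃ : cosetFreeB V q₃ 1 (X₃ : ZMod q₃) (Y₃ : ZMod q₃) = true)
    {X₁₂ Y₁₂ : ℤ}
    (hc₁₂ : zmodChord V q₁₂ (X₁ : ZMod q₁₂) (Y₁ : ZMod q₁₂) (X₂ : ZMod q₁₂) (Y₂ : ZMod q₁₂)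
      (X₁₂ : ZMod q₁₂) (Y₁₂ : ZMod q₁₂) = true)
    (hw₁₂ : cosetFreeB V q₁₂ 1 (X₁₂ : ZMod q₁₂) (Y₁₂ : ZMod q₁₂) = true)
    {X₁₃ Y₁₃ : ℤ}
    (hc₁₃ : zmodChord V q₁₃ (X₁ : ZMod q₁₃) (Y₁ : ZMod q₁₃) (X₃ : ZMod q₁₃) (Y₃ : ZMod q₁₃)
      (X₁₃ : ZMod q₁₃) (Y₁₃ : ZMod q₁₃) = true)
    (hw₁₃ : cosetFreeB V q₁₃ 1 (X₁₃ : ZMod q₁₃) (Y₁₃ : ZMod q₁₃) = true)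
    {X₂₃ Y₂₃ : ℤ}
    (hc₂₃ : zmodChord V q₂₃ (X₂ : ZMod q₂₃) (Y₂ : ZMod q₂₃) (X₃ : ZMod q₂₃) (Y₃ : ZMod q₂₃)
      (X₂₃ : ZMod q₂₃) (Y₂₃ : ZMod q₂₃) = true)
    (hw₂₃ : cosetFreeB V q₂₃ 1 (X₂₃ : ZMod q₂₃) (Y₂₃ : ZMod q₂₃) = true)
    {X₀ Y₀ X₁₂₃ Y₁₂₃ : ℤ}
    (hc₀ : zmodChord V q₁₂₃ (X₁ : ZMod q₁₂₃) (Y₁ : ZMod q₁₂₃) (X₂ : ZMod q₁₂₃) (Y₂ : ZMod q₁₂₃)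
      (X₀ : ZMod q₁₂₃) (Y₀ : ZMod q₁₂₃) = true)
    (hc₁₂₃ : zmodChord V q₁₂₃ (X₀ : ZMod q₁₂₃) (Y₀ : ZMod q₁₂₃) (X₃ : ZMod q₁₂₃) (Y₃ : ZMod q₁₂₃)
      (X₁₂₃ : ZMod q₁₂₃) (Y₁₂₃ : ZMod q₁₂₃) = true)
    (hw₁₂₃ : cosetFreeB V q₁₂₃ 1 (X₁₂₃ : ZMod q₁₂₃) (Y₁₂₃ : ZMod q₁₂₃) = true) :
    3 ≤ (V.map (Int.castRingHom ℚ)).mordellWeilRank := by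
  classical
  have hΔ : V.Δ ≠ 0 := Δ_ne_zero_of_not_dvd V hq₁
  haveI := isElliptic_rat V hΔ
  have hm' : Odd (m : ℤ) := by exact_mod_cast Nat.odd_iff.mpr hm
  have htors : ∀ x : (V.map (Int.castRingHom ℚ)).toAffine.Point, IsOfFinAddOrder x →
      ((2 : ℤ) ^ 1 * (m : ℤ)) • x = 0 :=
    fun x hx => torsion_zsmul_eq_zero_of_twoTorsionWitness V hte hS ht hT hT2 ℓ₁ hℓ₁ hodd hB₁ ℓ₂ hℓ₂ hB₂ x hx
  have e₁ : V.toAffine.Equation X₁ Y₁ := (Affine.equation_iff X₁ Y₁).mpr h₁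
  have e₂ : V.toAffine.Equation X₂ Y₂ := (Affine.equation_iff X₂ Y₂).mpr h₂
  have e₃ : V.toAffine.Equation X₃ Y₃ := (Affine.equation_iff X₃ Y₃).mpr h₃
  refine three_le_mordellWeilRank_of_cosetWitness (V.map (Int.castRingHom ℚ)) hm' htors
    (P₁ := .some _ _ (nonsingular_rat_of_eq V hΔ h₁))
    (P₂ := .some _ _ (nonsingular_rat_of_eq V hΔ h₂))
    (P₃ := .some _ _ (nonsingular_rat_of_eq V hΔ h₃)) ?_ ?_ ?_ ?_ ?_ ?_ ?_
  · refine not_mem_twoCoset_of_map_not_mem (reduceMod V q₁ hq₁) ?_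
    rw [reduceMod_some V q₁ hq₁ e₁]
    exact not_mem_twoCoset_of_cosetFreeB V q₁ hw₁ _
  · refine not_mem_twoCoset_of_map_not_mem (reduceMod V q₂ hq₂) ?_
    rw [reduceMod_some V q₂ hq₂ e₂]
    exact not_mem_twoCoset_of_cosetFreeB V q₂ hw₂ _
  · refine not_mem_twoCoset_of_map_not_mem (reduceMod V q₃ hq₃) ?_
    rw [reduceMod_some V q₃ hq₃ e₃]
    exact not_mem_twoCoset_of_cosetFreeB V q₃ hw₃ _
  · refine not_mem_twoCoset_of_map_not_mem (reduceMod V q₁₂ hq₁₂) ?_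
    rw [map_add, reduceMod_some V q₁₂ hq₁₂ e₁, reduceMod_some V q₁₂ hq₁₂ e₂]
    obtain ⟨h', e⟩ := exists_some_add_some_of_zmodChord V q₁₂ _ _ hc₁₂
    rw [e]
    exact not_mem_twoCoset_of_cosetFreeB V q₁₂ hw₁₂ _
  · refine not_mem_twoCoset_of_map_not_mem (reduceMod V q₁₃ hq₁₃) ?_
    rw [map_add, reduceMod_some V q₁₃ hq₁₃ e₁, reduceMod_some V q₁₃ hq₁₃ e₃]
    obtain ⟨h', e⟩ := exists_some_add_some_of_zmodChord V q₁₃ _ _ hc₁₃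
    rw [e]
    exact not_mem_twoCoset_of_cosetFreeB V q₁₃ hw₁₃ _
  · refine not_mem_twoCoset_of_map_not_mem (reduceMod V q₂₃ hq₂₃) ?_
    rw [map_add, reduceMod_some V q₂₃ hq₂₃ e₂, reduceMod_some V q₂₃ hq₂₃ e₃]
    obtain ⟨h', e⟩ := exists_some_add_some_of_zmodChord V q₂₃ _ _ hc₂₃
    rw [e]
    exact not_mem_twoCoset_of_cosetFreeB V q₂₃ hw₂₃ _
  · refine not_mem_twoCoset_of_map_not_mem (reduceMod V q₁₂₃ hq₁₂₃) ?_
    rw [map_add, map_add, reduceMod_some V q₁₂₃ hq₁₂₃ e₁, reduceMod_some V q₁₂₃ hq₁₂₃ e₂,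
      reduceMod_some V q₁₂₃ hq₁₂₃ e₃]
    obtain ⟨h', e⟩ := exists_some_add_some_of_zmodChord V q₁₂₃ _ _ hc₀
    rw [e]
    obtain ⟨h'', e'⟩ := exists_some_add_some_of_zmodChord V q₁₂₃ _ _ hc₁₂₃
    rw [e']
    exact not_mem_twoCoset_of_cosetFreeB V q₁₂₃ hw₁₂₃ _

end Assembly

end Summit.BirchSwinnertonDyer.BirchSwinnertonDyer.Rank2Observatory
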